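import Summits.NavierStokesRegularity.NavierStokesRegularity.Theorems.CalmSliceGatePerpetualFlickerLiouvilleLinks
import Summits.NavierStokesRegularity.NavierStokesRegularity.Theorems.CalmSliceGateOneSymmetricSlice
import HarnessLib

/-!
# `AsymmetricFlickerLiouville` (crux stmt-NavierStokesRegularity-24453, route `CalmSliceGate`):
# the crux AS TYPED is `FiniteDissipationLiouville` — the flicker floor and the asymmetry floor
# are NOT load-bearing

Refuter-side load-bearing certificate (seat ns-afl-r1 g6, `--supports stmt-NavierStokesRegularity-24453`,
Negative lane).  The crux quantifies over members `w` of the finite-dissipation Type-I stratum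
`𝒟_{C,K}` (`IsTypeIAncientMild C w` + the slice law `∫|∇w(s)|² ≤ K/√(−s)`) with two extra hypothesis
schemata — (hF) perpetual flicker: unsteadiness `> δ` somewhere on `B(0, R√(−t))` at every `t < 0`;
(hA) total asymmetry: every slice is `δ′`-far on `B(0, R′√(−t))` from axisymmetry about EVERY axis
through the apex — and concludes apex-regularity.  Both converters of the route are PROVED in the
tree: K1 `oneCalmSlice_proof` (p595719; packaged as `PerpetualFlickerLiouville.Links.flicker_of_singular`:
every SINGULAR member flickers with the floor `(δ(C,K), R(C,K))`) and LINE 2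
`oneSymmetricSlice_proof` (every member with ONE `δ′`-almost-axisymmetric slice is apex-regular).
Hence, by pure logic:

* `asymmetric_of_singular` — every SINGULAR member of `𝒟_{C,K}` is totally asymmetric on every
  slice with the LINE-2 floor `(δ′(C,K), R′(C,K))` (contrapositive of `oneSymmetricSlice_proof`);
* `finiteDissipationLiouville_iff_asymmetricFlickerLiouville` — **the crux AS TYPED is EQUIVALENT to
  LQD's `FiniteDissipationLiouville` (stmt-NavierStokesRegularity-22144)**: forward, restrict; backward,
  a singular member of `𝒟_{C,K}` satisfies (hF) at `(δ, R)(C,K)` and (hA) at `(δ′, R′)(C,K)`, so the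
  crux applies to it;
* `perpetualFlickerLiouville_iff_asymmetricFlickerLiouville` — likewise for the parent crux
  `PerpetualFlickerLiouville` (stmt-24374; composed with the landed
  `finiteDissipationLiouville_iff_perpetualFlickerLiouville`).

READING (refuter): in the kernel the hypothesis schemata (hF), (hA) can be DELETED from 24453 without
changing its truth value — any proof of 24453 is a proof of 22144 and conversely; the value of the
split is scenario bookkeeping (calm / near-axisymmetric members are excluded BY THEOREMS), not a
smaller formal target.  A refutation of 24453 is therefore exactly a refutation of 22144: a singular
member of some `𝒟_{C,K}` (Bradshaw–Tsai OP 5.1 ∩ finite dissipation), nothing less.  The critic's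
identity «AsymmetricFlickerLiouville ⟺ FDL modulo K1 ∧ OneSymmetricSlice» (idea-crit-3, 01:24Z) is
hereby unconditional.  HONEST FRAMING: nothing here proves or refutes 24453, 22144, 24374 or
Navier–Stokes regularity; all stay OPEN; no summit statement is proved by this file.
-/

noncomputable section

-- the summit and its single sub-problem share the name (CONVENTIONS §1), as in every Theorems file
set_option linter.dupNamespace false

namespace Summit.NavierStokesRegularity.NavierStokesRegularity.Theorems.AsymmetricFlickerLiouville.Negative

open MeasureTheory Set Filter Topology Metric Function
open Literature.Analysis Literature.Analysis.FluidPDE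
open Summit.NavierStokesRegularity.NavierStokesRegularity.Theorems
open scoped ENNReal NNReal

/-- **Every singular member of `𝒟_{C,K}` is totally asymmetric on every slice** with the LINE-2
floor: there are `δ′(C,K), R′(C,K) > 0` such that a member singular at the apex has, at EVERY
`t < 0` and for EVERY linear isometry `g` (axis `g e₃`), an angle `θ` and a point
`x ∈ B(0, R′√(−t))` with `√(−t)‖w(t, g R_θ g⁻¹ x) − g R_θ g⁻¹ w(t, x)‖ > δ′` (contrapositive of
`oneSymmetricSlice_proof`). [cite: SereginSverak2009, Thm. 3.1 (= Thm. 1.1)] -/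
theorem asymmetric_of_singular (C K : ℝ) : ∃ δ' > 0, ∃ R' > 0,
    ∀ (w : ℝ → EuclideanSpace ℝ (Fin 3) → EuclideanSpace ℝ (Fin 3)),
      IsTypeIAncientMild C w →
      (∀ s : ℝ, s < 0 → ∫⁻ x, ‖fderiv ℝ (w s) x‖ₑ ^ 2 ≤ ENNReal.ofReal (K / Real.sqrt (-s))) →
      (∀ r > 0, ∀ M : ℝ, ∃ t ∈ Ioo (-(r ^ 2)) (0 : ℝ),
        ∃ x ∈ ball (0 : EuclideanSpace ℝ (Fin 3)) r, M < ‖w t x‖) →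
      ∀ t < 0, ∀ g : EuclideanSpace ℝ (Fin 3) ≃ₗᵢ[ℝ] EuclideanSpace ℝ (Fin 3), ∃ θ : ℝ,
        ∃ x ∈ ball (0 : EuclideanSpace ℝ (Fin 3)) (R' * Real.sqrt (-t)),
          δ' < Real.sqrt (-t) * ‖w t (g (rotZ θ (g.symm x))) - g (rotZ θ (g.symm (w t x)))‖ := by
  have h2 := oneSymmetricSlice_proof
  unfold Summit.NavierStokesRegularity.NavierStokesRegularity.Theses.CalmSliceGate.OneSymmetricSlice at h2
  obtain ⟨δ', hδ', R', hR', hL2⟩ := h2 C K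
  refine ⟨δ', hδ', R', hR', fun w hw hlaw hsing t ht g => ?_⟩
  by_contra hsym
  push Not at hsym
  exact hL2 w hw hlaw ⟨t, ht, g, fun θ x hx => hsym θ x hx⟩ hsing

/-- **`FiniteDissipationLiouville ⟺ AsymmetricFlickerLiouville`**: the crux 24453 AS TYPED is LQD's
crux 22144 — forward, a flickering totally-asymmetric member is in particular a member; backward,
every singular member flickers (K1, `flicker_of_singular`) and is totally asymmetric on every slice
(LINE 2, `asymmetric_of_singular`), so 24453 excludes it. Pure logic over the two PROVED converters. -/
theorem finiteDissipationLiouville_iff_asymmetricFlickerLiouville :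
    Summit.NavierStokesRegularity.NavierStokesRegularity.Theses.LerayQuarterDissipation.FiniteDissipationLiouville ↔
      Summit.NavierStokesRegularity.NavierStokesRegularity.Theses.CalmSliceGate.AsymmetricFlickerLiouville := by
  unfold Summit.NavierStokesRegularity.NavierStokesRegularity.Theses.LerayQuarterDissipation.FiniteDissipationLiouville
    Summit.NavierStokesRegularity.NavierStokesRegularity.Theses.CalmSliceGate.AsymmetricFlickerLiouville
  constructor
  · intro h C K δ R δ' R' _ _ _ _ w hw hlaw _ _
    exact h C K w hw hlaw
  · intro h C K w hw hlaw hsing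
    obtain ⟨δ, hδ, R, hR, hfl⟩ := PerpetualFlickerLiouville.Links.flicker_of_singular C K
    obtain ⟨δ', hδ', R', hR', hasym⟩ := asymmetric_of_singular C K
    exact h C K δ R δ' R' hδ hR hδ' hR' w hw hlaw (hfl w hw hlaw hsing) (hasym w hw hlaw hsing) hsing

/-- **`PerpetualFlickerLiouville ⟺ AsymmetricFlickerLiouville`**: the child 24453 AS TYPED is its
parent 24374 (compose with the landed `finiteDissipationLiouville_iff_perpetualFlickerLiouville`). -/
theorem perpetualFlickerLiouville_iff_asymmetricFlickerLiouville :
    Summit.NavierStokesRegularity.NavierStokesRegularity.Theses.CalmSliceGate.PerpetualFlickerLiouville ↔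
      Summit.NavierStokesRegularity.NavierStokesRegularity.Theses.CalmSliceGate.AsymmetricFlickerLiouville :=
  PerpetualFlickerLiouville.Links.finiteDissipationLiouville_iff_perpetualFlickerLiouville.symm.trans
    finiteDissipationLiouville_iff_asymmetricFlickerLiouville

/-- **The two extra hypothesis schemata of 24453 are removable**: `AsymmetricFlickerLiouville` implies
the same statement with the flicker floor (hF) and the asymmetry floor (hA) deleted (which is
`FiniteDissipationLiouville` verbatim).  Recorded in the `_iff_without_` shape of the Negative lane. -/
theorem asymmetricFlickerLiouville_iff_without_floors :
    Summit.NavierStokesRegularity.NavierStokesRegularity.Theses.CalmSliceGate.AsymmetricFlickerLiouville ↔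
      ∀ (C K : ℝ) (w : ℝ → EuclideanSpace ℝ (Fin 3) → EuclideanSpace ℝ (Fin 3)),
        IsTypeIAncientMild C w →
        (∀ s : ℝ, s < 0 → ∫⁻ x, ‖fderiv ℝ (w s) x‖ₑ ^ 2 ≤ ENNReal.ofReal (K / Real.sqrt (-s))) →
        ¬ (∀ r > 0, ∀ M : ℝ, ∃ t ∈ Set.Ioo (-(r ^ 2)) (0 : ℝ),
          ∃ x ∈ Metric.ball (0 : EuclideanSpace ℝ (Fin 3)) r, M < ‖w t x‖) :=
  finiteDissipationLiouville_iff_asymmetricFlickerLiouville.symm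

end Summit.NavierStokesRegularity.NavierStokesRegularity.Theorems.AsymmetricFlickerLiouville.Negative

end
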